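import Literature.NumberTheory.Sieve.HardyLittlewoodTwinSieveBFIProofs
import Literature.NumberTheory.Sieve.BombieriFriedlanderIwaniecDispersionLeaves
import Literature.NumberTheory.Sieve.BombieriFriedlanderIwaniecTheorem1Assembly
import Literature.NumberTheory.Sieve.BombieriFriedlanderIwaniecTheorem2
import Literature.NumberTheory.Sieve.BombieriFriedlanderIwaniecDispersionLemma7
import HarnessLib

/-!
# The twin-prime sieve constant `7/2` (BFI 1986, Corollary 2) from BFI's Lemma 1 alone (misprinted form — see Status)

Topic `Literature/NumberTheory/Sieve`.  Everything here is PROVED; no named fact is introduced.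

E. Bombieri, J. B. Friedlander, H. Iwaniec, *Primes in arithmetic progressions to large moduli*,
Acta Math. 156 (1986), 203–251, §1 **Corollary 2** (p. 209): `π₂(x) ≤ (7/2 + ε) B x (log x)⁻²`,
`B = 2 ∏_{p>2} (1 − (p−1)⁻²)`, for any `ε > 0` and `x ≥ x₀(ε)` — the named fact
`Literature.NumberTheory.Sieve.twinSieve_bfi` (`= TwinSieveUpperBound (7/2)`).

The tree proves Corollary 2 from Theorem 10 in its `π`-form
(`twinSieve_bfi_of_theorem10Pi`, file `…HardyLittlewoodTwinSieveBFIProofs`: the well-factorable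
linear sieve `Iwaniec1980b.WF.sifted_le_wellFactorable` and the glue of p. 251), Theorem 10 from
Theorems 1, 2, 5 (`BombieriFriedlanderIwaniecTheorem10Pi_of_theorem1_theorem2_theorem5`, file
`…BombieriFriedlanderIwaniecDispersionLeaves`: §§10, 13, 15, 17, Theorem 0, Lemma 3 = Shiu's
theorem, Theorem 5* from Theorem 5, the `ψ → π` passage), and Theorems 1, 2, 5 from BFI's Lemma 1
(`BombieriFriedlanderIwaniecTheorem1_of_lemma1`, file `…Theorem1Assembly`, §§3–8;
`BFI.BombieriFriedlanderIwaniecTheorem2_of_lemma7 ∘ BFI.lemma7_dispBm_of_lemma1`, files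
`…Theorem2`, `…DispersionLemma7`, §9; `BombieriFriedlanderIwaniecTheorem5_of_lemma1`, file
`…Lemma6`, §12) — the same composition as `BombieriFriedlanderIwaniecTheorem10Pi_of_lemma1` of
`…BombieriFriedlanderIwaniecTheorem10FromLemma1`, inlined here from its constituents.  This file
composes them: **Corollary 2 is conditional on exactly BFI's Lemma 1** (§2, p. 210) —
J.-M. Deshouillers, H. Iwaniec, *Kloosterman sums and Fourier coefficients of cusp forms*, Invent.
Math. 70 (1982), 219–288, Theorem 12 (Kuznetsov's formula and the spectral theory of `Γ₀(rs)∖ℍ`,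
in neither Mathlib nor the tree) — for the single smooth weight `w ⊗ w` (`BFI.plateau2`,
supported in `[1/4, 5/4]²`) in the ranges `C, D, N ≥ 1`, `R, S ≥ 1/2`, i.e. the hypothesis
`BFI.Lemma1BoundFor BFI.plateau2 (5/4)`, or for its printed form quantified over all smooth
weights of compact support in `ℝ⁺ × ℝ⁺` (support rendered as a box `[a, b]²`, `0 < a ≤ b`).

## Status (2026-08-15): the hypothesis of this file is the MISPRINTED Lemma 1 and is refuted

BFI's Lemma 1 as printed in 1986 (last term `D²NRS⁻¹` of `𝓘²`, the tree's `BFI.lemma1I`) is a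
slip: E. Bombieri, J. B. Friedlander, H. Iwaniec, *Some corrections to an old paper*,
arXiv:1903.01371 (2019), §2 Lemma 2.1, restate it with last term `D²NR` — "This is somewhat weaker
than the version quoted in [DI] and [BFI] where, in the final term, the quantity `D²NR` was stated
as `D²NRS⁻¹`.  The above corrected version is already sufficient for our applications. … In most
of our uses of this lemma we have `S = 1` so things remain as before" (the statements of all
theorems of BFI 1986, in particular Theorem 10 and Corollary 2, are unaffected: loc. cit.,
Abstract).  The tree PROVES that the misprinted predicate is false for this very weight,
`BFI.L1R.not_lemma1BoundFor_plateau2 : ¬ BFI.Lemma1BoundFor BFI.plateau2 (5/4)` and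
`BFI.L1R.not_lemma1BoundFor_printed` (file `…BombieriFriedlanderIwaniecLemma1Refutation`), so the
two theorems below, though correct, have an UNSATISFIABLE hypothesis and can never yield
`twinSieve_bfi_holds`.  They are kept verbatim (append-only tree; the module is imported by
`…BombieriFriedlanderIwaniecTheorem10FromLemma1Corrected`).  The honest reductions of Corollary 2
are `twinSieve_bfi_of_lemma1corr` (hypothesis `BFI.Lemma1BoundCorrected BFI.plateau2 (5/4)`, the
corrected Lemma 2.1 for `w ⊗ w`) and `twinSieve_bfi_of_k1Half` (its `S = 1/2` instance
`BFI.K1HalfFor BFI.plateau2 (5/4)`, all that the proofs of Lemmas 6 and 7 consume), both in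
`…BombieriFriedlanderIwaniecTheorem10FromLemma1Corrected`; the corrected bound is in turn reduced to
its off-diagonal (Kuznetsov) part by `BFI.lemma1BoundCorrected_plateau2_of_offdiag`
(`…BombieriFriedlanderIwaniecLemma1Completion`).  The discharge `twinSieve_bfi_holds` is the
one-liner `twinSieve_bfi_of_lemma1corr h` (or `twinSieve_bfi_of_theorem10Pi
BombieriFriedlanderIwaniecTheorem10Pi_holds`) as soon as the corrected bound — Deshouillers–Iwaniec,
Invent. Math. 70 (1982), Theorem 12 with (9.11) corrected — is a theorem of the tree.

## Main statements

* `twinSieve_bfi_of_lemma1` — Corollary 2 from the (misprinted, refuted) Lemma 1 for the weight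
  `w ⊗ w` — superseded by `twinSieve_bfi_of_lemma1corr` / `twinSieve_bfi_of_k1Half`;
* `twinSieve_bfi_of_lemma1'` — Corollary 2 from the printed (all smooth weights) misprinted
  Lemma 1 — hypothesis refuted by `BFI.L1R.not_lemma1BoundFor_printed`; superseded by
  `twinSieve_bfi_of_lemma1corr'`.

## References

* E. Bombieri, J. B. Friedlander, H. Iwaniec, Acta Math. 156 (1986), 203–251: §1 Corollary 2 and
  Theorem 10, p. 209; §2 Lemma 1, p. 210; §17, p. 251. [BombieriFriedlanderIwaniecActa1986]
* H. Iwaniec, *A new form of the error term in the linear sieve*, Acta Arith. 37 (1980), 307–320,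
  Theorem 1. [IwaniecActaArith1980b]
* J.-M. Deshouillers, H. Iwaniec, Invent. Math. 70 (1982), 219–288, Theorem 12 (BFI's
  reference [2]); bound (9.11) corrected in 2019.
* E. Bombieri, J. B. Friedlander, H. Iwaniec, *Some corrections to an old paper*, arXiv:1903.01371
  (2019), Abstract and §2 Lemma 2.1 (arXiv p. 3). [BombieriFriedlanderIwaniec2019]
-/

namespace Literature.NumberTheory.Sieve

open scoped ContDiff

/-- **Bombieri–Friedlander–Iwaniec 1986, Corollary 2 (`π₂(x) ≤ (7/2 + ε) · 2C₂ x/log²x` for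
`x ≥ x₀(ε)`) from their Lemma 1 alone**, for the weight `w ⊗ w` in the ranges `C, D, N ≥ 1`,
`R, S ≥ 1/2`: `twinSieve_bfi_of_theorem10Pi` ("Corollary 2 is an immediate consequence of
Theorem 10 and of the linear sieve result of [15]", p. 251) composed with Theorem 10 (`π`-form)
from Theorems 1, 2, 5 (§§10–17) and those from Lemma 1 (§§3–9, 12).
**Hypothesis refuted** (`BFI.L1R.not_lemma1BoundFor_plateau2`: the 1986 printing of Lemma 1, last
term `D²NRS⁻¹`, is a slip corrected to `D²NR` in BFI 2019, §2 Lemma 2.1); this implication is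
therefore vacuous — use `twinSieve_bfi_of_lemma1corr` or `twinSieve_bfi_of_k1Half`
(`…Theorem10FromLemma1Corrected`), whose hypothesis is the corrected, published bound.
[cite: BombieriFriedlanderIwaniecActa1986, §1 Corollary 2 p. 209; §2 Lemma 1 p. 210; §17 p. 251; correction of Lemma 1: BombieriFriedlanderIwaniec2019, §2 Lemma 2.1] -/
theorem twinSieve_bfi_of_lemma1 (hLB : BFI.Lemma1BoundFor BFI.plateau2 (5 / 4)) : twinSieve_bfi :=
  twinSieve_bfi_of_theorem10Pi
    (BombieriFriedlanderIwaniecTheorem10Pi_of_theorem10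
      (BombieriFriedlanderIwaniecTheorem10_of_theorem1_theorem2_theorem5
        (BombieriFriedlanderIwaniecTheorem1_of_lemma1 hLB)
        (BFI.BombieriFriedlanderIwaniecTheorem2_of_lemma7 (BFI.lemma7_dispBm_of_lemma1 hLB))
        (BombieriFriedlanderIwaniecTheorem5_of_lemma1 hLB)))

/-- **Bombieri–Friedlander–Iwaniec 1986, Corollary 2, from the printed Lemma 1** (quantified over
all smooth weights `g₀` of compact support in `ℝ⁺ × ℝ⁺`, support rendered as a box `[a, b]²`,
`0 < a ≤ b`), through the instance `g₀ = w ⊗ w`, `[a, b] = [1/4, 5/4]` (`BFI.contDiff_plateau2`,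
`BFI.plateau2_eq_zero`).  **Hypothesis refuted** (`BFI.L1R.not_lemma1BoundFor_printed`; the 1986
printing of Lemma 1 is corrected in BFI 2019, §2 Lemma 2.1) — vacuous; superseded by
`twinSieve_bfi_of_lemma1corr'` (`…Theorem10FromLemma1Corrected`).
[cite: BombieriFriedlanderIwaniecActa1986, §1 Corollary 2 p. 209; §2 Lemma 1 p. 210; correction of Lemma 1: BombieriFriedlanderIwaniec2019, §2 Lemma 2.1] -/
theorem twinSieve_bfi_of_lemma1'
    (h1 : ∀ g₀ : ℝ → ℝ → ℝ, ContDiff ℝ ∞ (fun p : ℝ × ℝ => g₀ p.1 p.2) →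
      ∀ a b : ℝ, 0 < a → a ≤ b →
        (∀ ξ η : ℝ, ¬ (ξ ∈ Set.Icc a b ∧ η ∈ Set.Icc a b) → g₀ ξ η = 0) →
          BFI.Lemma1BoundFor g₀ b) :
    twinSieve_bfi :=
  twinSieve_bfi_of_lemma1
    (h1 BFI.plateau2 BFI.contDiff_plateau2 (1 / 4) (5 / 4) (by norm_num) (by norm_num)
      fun _ _ h => BFI.plateau2_eq_zero h)

end Literature.NumberTheory.Sieve
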